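import Summits.QuantumFields.QCD.Theses.DiagonalSpine
import HarnessLib.Audit

/-!
# Birth skeleton (BC3) for crux `LatticeToContinuum` (item stmt-QuantumFields-8929) — `Lines/birth.lean`

Route `route-QuantumFields-DiagonalSpine` (sub-problem QCD), crux decl
`Summit.QuantumFields.QCD.Theses.DiagonalSpine.LatticeToContinuum := FullLatticeGap → QCD` (rank 3, XL; the
CONTINUUM HALF of the spine: from the lattice half's regularisation reach, along ONE sequence of spacings serving
all quark masses, OS data with `IsQCDAlong`, E0–E4, the species clauses, `HasMassGap` and `IsChiralAtZero` for
`N_f = 2, 3`).  Registered by the skeleton-registrar seat `planner-skel-stmt-QuantumFields-8929-0` (route re-audit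
bin REPAIRABLE, 2026-08-17).  LINE = THE ROUTE'S OWN TWO-LAYER PLAN, KERNEL-CHECKED: the crux is cut exactly along
the header's foreseen layer-2 modules — five of them are FILED cruxes of the route taken BY NAME (staffed once, closed
by the gate when their items close), the sixth is the header's NOT-DECOMPOSED-YET node `OSClosureAndClauses` typed
here for the first time, and a seventh, `VolumeUpgrade`, isolates the one hypothesis the header says that node must
be filed over (polynomial volume growth):

  `LatticeToContinuum ⇐ LightQuarkGap (#7) → ChiralTuning (#8) → VolumeUpgrade (new) → CalibratedTightness (#5) →
   MassEquicontinuity (#6) → OSClosureAndClauses (new; uses RotationRestoration (#4) at the given N_f)`,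

glued by a REAL proof (§3–§4): the `N_f = 2, 3` case split of `QCD = QCDOf 2 ∧ QCDOf 3`, the re-threading of
`FullLatticeGap`'s (possibly decoupled) witness through three `∃ reg` upgrades (honest ⟶ chirally tuned ⟶
polynomial volumes), the calibrated family and its Lipschitz modulus fed to the OS-closure node, and then the two
tail transports that turn the node's output (the massive `QCDOf` body along a RESTRICTION `reg ∘ φ`) into the
re-typed conjunct: `HasMassScaling` survives the restriction (`hasMassScaling_restrict`) and the Goldstone bound G
of `reg` makes the restriction CHIRAL AT ZERO (`isChiralAtZero_restrict`, via `not_hasLatticeMassGap_of_slow_decay_tori`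
— the `S_k ≥ L_k`-tori form of the landed consumption lemma `Cruxes.StableActionBridge.Sketch.not_hasLatticeMassGap_of_slow_decay`).
This is the content of the route's supports `SubsequenceStability` / `GoldstonePersistence` that the composition
needs, proved here rather than stubbed.

## The seven stubs (the ONLY `sorry`s of this file)
* `stub_lightQuarkGap : LightQuarkGap` (item stmt-QuantumFields-14656, crux r7, open-problem) — H1–H3 witness ⟶
  HONEST regularisation with H4 lattice non-decoupling.
* `stub_chiralTuning : ChiralTuning` (item stmt-QuantumFields-17436, crux r8, open-problem) — honest ⟶ pinned to the
  chiral point: H1–H4 ∧ G (eventual Goldstone lower bound, subsequence-stable).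
* `stub_volumeUpgrade : VolumeUpgrade` (NEW statement, typed here; size M–L) — H1–H4 ∧ G survive a POLYNOMIAL
  ENLARGEMENT OF THE TORI (`∃ θ > 0, ∀ᶠ k, a_k^{−θ} ≤ a_k L_k`).  H1, H2 do not read `L`; H3 is volume-monotone
  (`HasLatticeMassGap` quantifies all tori `S ≥ L_k`); the content is the finite-volume robustness of the connected
  two-point functions entering H4 and of the Goldstone channel entering G (thermodynamic limit from uniform
  clustering, wrap-around `O(e^{−Δ a_k L_k})`).  Why it might fail: G's witness tori `S_k` are tied to the OLD `L_k`
  and a Goldstone LOWER bound on larger tori is new information near the chiral point; H4's ratio bound needs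
  volume-independence of `C_k(m; Θg, τ g)` uniformly on compacts of masses.
* `stub_rotationRestoration : RotationRestoration` (item stmt-QuantumFields-8840, crux r4, open-problem) — E1 for
  sequential lattice limits along AF trajectories with a lattice gap; used at the given `N_f` (`RotationsRestoredFor`).
* `stub_calibratedTightness : CalibratedTightness` (item stmt-QuantumFields-14675, crux r5) — a LIVE calibrated
  species family, TIGHT-LOCAL on ⁰𝒮, locally uniformly in the masses (fermionic UV stability in ratio form).
* `stub_massEquicontinuity : MassEquicontinuity` (item stmt-QuantumFields-14676, crux r6) — the gap as Arzelà–Ascoli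
  modulus: lattice n-point functions Lipschitz in `m` on compacts, `∀ᶠ k`, compactly supported off-diagonal tuples.
* `stub_osClosure : OSClosureAndClauses` (NEW statement, typed here; size XL) — OS CLOSURE AND THE LOWER-BOUND
  CLAUSES ALONG ONE DIAGONAL SUBSEQUENCE: for `N_f ∈ {2,3}`, rotations restored at `N_f`, every reg with H1–H4 and
  polynomial volume growth, and every calibrated family that is live, tight-local and mass-Lipschitz, there is ONE
  strictly increasing `φ` and the restriction `reg' = reg ∘ φ` (same `a, β, L, m_crit, Z_m` composed with `φ`) along
  which, for EVERY positive mass tuple, species renormalisations and OS data exist with `IsQCDAlong`, non-trivial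
  non-Gaussian glue, dynamical quarks and one `Δ > 0` with `T.HasMassGap Δ ∧ HasLatticeMassGap Δ` — the `QCDOf` body
  WITHOUT `HasMassScaling`/`IsChiralAtZero` (those are transported by the glue).  Content: the diagonal lemma over the
  countable index (n × species strings × a countable dense set of compactly supported off-diagonal real tensor
  tuples, masses in an exhaustion by compacts), extension to ⁰𝒮 with Schwartz tails at the box faces beaten by the
  polynomial volume (weight `(a_k L_k)^{−2s}` against the seam contact `a_k⁻¹`), closedness of E0′, E2–E4 and of the
  gap under the limit, E1 from the rotation hypothesis, `IsNontrivial`/`IsNonGaussian glue` by RP window bounds and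
  the m-odd quark triangle, `IsNontrivial (pseudoRe f g)` from H4 + calibration.  Why it might fail: the gap constants
  of `HasLatticeMassGap` are per observable pair with no m-uniformity (gap of the LIMIT needs a uniform rate on a
  generating class); liveness gives `= 1` at one distance only, so non-Gaussianity needs a genuine lower bound; the
  continuum gap `T.HasMassGap Δ(m)` must hold with the SAME `Δ` as the lattice clause.

## Negative knowledge honoured (read 2026-08-17)
* `ledger crux ls stmt-QuantumFields-8929`: no `Disproof.lean`, no Ideas, no Lines before this file — nothing to
  import; no `_false_without_` obstruction exists for this crux.
* Item evidence `rev7_memo.md` (MultibosonBridge planner, 2026-08-16): after the re-type, `FullLatticeGap → QCD`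
  silently asks `IsChiralAtZero` of a regularisation that may be PARKED, and the plain clause is not
  subsequence-stable (`¬∀ᶠ = ∃ᶠ`).  Honoured exactly as the DiagonalSpine header prescribes: chirality enters through
  `ChiralTuning`'s EVENTUAL Goldstone bound G (an `∀ᶠ k` lower bound, stable under `φ`), and §3 PROVES
  `G reg → (reg ∘ φ).IsChiralAtZero`; the parked witness of `FullLatticeGap` is upgraded by `LightQuarkGap` first.
* Refuter evidence on CalibratedTightness gen 3 / MassEquicontinuity gen 3 (stmt-QuantumFields-14654, EVIDENCE.md,
  kit j013894): the PERIODIC SEAM of the box-truncated smearing (`≍ a_k⁻¹`) makes fixed Schwartz tuples with Gaussian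
  tails unbounded on regularisations with `(L_k a_k)² ≲ log a_k⁻¹`.  Honoured: `OSClosureAndClauses` is asked only over
  regularisations with POLYNOMIAL VOLUME GROWTH (the header's own prescription, "NOT DECOMPOSED YET"), supplied by the
  separate stub `VolumeUpgrade`; its other hypotheses are the repaired (C′) forms verbatim.
* `ledger negatives --problem QuantumFields` (5 entries, 2026-08-17: RobustYangMillsRG 14958, DiagonalMirrorRP 9665,
  AdaptiveCoarseSystem 9494, MultibosonLatticeGap 9599 — monic multiboson data, AdmissibleRootsExist 9603): none is a
  statement about volume enlargement, OS closure, or the five filed cruxes; no stub is an instance of a refuted one.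
* Landed `Theorems/QuarksAsStableActionStableActionBridgeChiralCriterion.lean` (`not_hasLatticeMassGap_of_slow_decay`,
  `isChiralAtZero_of_goldstone` at `S = L_k`): re-derived here at tori `S_k ≥ L_k` (G's shape), not contradicted.

## Check (lean check --json, farm, 2026-08-17)
rc 0, errors [], sorries 7 = the seven `stub_*` (the only warnings: `declaration uses sorry` at their seven
declaration lines), zero elsewhere; `LatticeToContinuum_of` axioms `[propext, Classical.choice, Quot.sound]` (no
`sorryAx`); H21 audit: `latticeToContinuum_of_stubs` = proof-of-item of
`Summit.QuantumFields.QCD.Theses.DiagonalSpine.LatticeToContinuum` (NOT closed: `sorryAx` via the stubs, intended),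
`stub_lightQuarkGap/…/stub_massEquicontinuity` = proof-of-item of the five filed decls (sorried), the four §3 glue
lemmas closed support; the local statement defs are flagged `vendored-fact` (untagged `def : Prop`, advisory).

## BC3 probes (registrar folder `bc/probe_<Stub>_{crux,summit}.lean`; by-name stubs import ONLY the route file, the
two new statements are copied verbatim with §0; no `stub_*`, no composition in scope; `maxHeartbeats 400000` EACH)
For each of the 7 stubs `X` and each target `Y ∈ {LatticeToContinuum, QCD}`: probe 0 `first | exact? | simpa [X] |
(unfold X; simpa) | aesop` and probes 1–4 = `exact?` · `simpa [X, Y…]` · `unfold X Y…; simpa` · `aesop` alone —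
ALL 70 EXAMPLES FAIL (14 files, rc 1 each, 5 errors at the 5 example lines: `exact?` "could not close the goal" in
all 14; `simpa`/`unfold;simpa` "assumption failed ⊢ <X unfolded> → …" or heartbeat timeout at `whnf`/`isDefEq`;
`aesop` "failed to prove the goal after exhaustive search"; wall 19–197 s per file).  Supplementary
`bc/probe_joint_seam.lean` (4 000 000 heartbeats): ALL SEVEN stub statements jointly → `LatticeToContinuum` by
`first | exact? | aesop`, and after `intro`s by `first | exact? | aesop | (constructor <;> aesop)` — BOTH FAIL
(`⊢ QCDOf 2`, `⊢ QCDOf 3` untouched): no stub is cheaply the crux or the summit, and the seam is not a one-liner.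
-/

noncomputable section

namespace Summit.QuantumFields.QCD.Cruxes.LatticeToContinuum.Birth

open Filter
open Literature.MathematicalPhysics.QuantumFieldTheory Literature.MathematicalPhysics.QuantumLattice
  Literature.MathematicalPhysics.AQFT
open Summit.QuantumFields.QCD.Theses.DiagonalSpine (FullLatticeGap LatticeToContinuum LightQuarkGap
  ChiralTuning RotationRestoration CalibratedTightness MassEquicontinuity)

variable {Nf : ℕ}

/-! ## §0 Verbatim names for the recurring sub-formulas of the route's decls -/

/-- H3 of `FullLatticeGap` / `LightQuarkGap` / `ChiralTuning` (verbatim): physical branch and a uniform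
lattice gap at every positive mass tuple. -/
def PhysicalBranchGap (reg : QCDRegularisation Nf) : Prop :=
  ∀ m : Fin Nf → ℝ, (∀ f, 0 < m f) →
    (∀ f, ∀ᶠ k in Filter.atTop, -1 < (reg.scheme m 0 0).mq f k) ∧ ∃ Δ > 0, (reg.scheme m 0 0).HasLatticeMassGap Δ

/-- H4 LATTICE NON-DECOUPLING (verbatim the consequent clause of `LightQuarkGap`, the hypothesis of
`CalibratedTightness`). -/
def NonDecoupling (reg : QCDRegularisation Nf) : Prop :=
  ∀ K : Set (Fin Nf → ℝ), IsCompact K → K ⊆ {m | ∀ fl, 0 < m fl} → ∀ s : QCDField Nf,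
    (∀ fl, s ≠ QCDField.pseudoIm fl fl) → ∀ (t₁ t₂ : ℝ), 0 < t₁ → ∀ g : SchwartzMap (EuclideanSpace ℝ (Fin 4)) ℝ,
      tsupport g ⊆ timeSlab 4 t₁ t₂ → ∀ T : ℝ, ∃ c > 0, ∀ᶠ k in Filter.atTop, ∀ m ∈ K, ∀ j : ℕ,
        (j : ℝ) * reg.a k ≤ T →
          c * ‖(reg.scheme m 1 0).connectedTwoPoint k s s (thetaTest 4 g) g‖ ≤
            ‖(reg.scheme m 1 0).connectedTwoPoint k s s (thetaTest 4 g) (timeShiftTest 4 ((j : ℝ) * reg.a k) g)‖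

/-- G, the EVENTUAL GOLDSTONE LOWER BOUND (verbatim the last conjunct of `ChiralTuning`'s consequent). -/
def GoldstoneBound (reg : QCDRegularisation Nf) : Prop :=
  ∀ ε > (0 : ℝ), ∃ m : Fin Nf → ℝ, (∀ f, 0 < m f) ∧ ∃ μ c : ℝ, μ < ε ∧ 0 < c ∧
    ∃ (R R' : ℕ) (A : QCDLatticeObservable Nf R) (B : QCDLatticeObservable Nf R') (S n : ℕ → ℕ),
      (∀ k, reg.L k ≤ S k) ∧ (∀ k, n k ≤ S k) ∧ Filter.Tendsto (fun k => reg.a k * n k) Filter.atTop Filter.atTop ∧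
        ∀ᶠ k in Filter.atTop, c * Real.exp (-(μ * (reg.a k * n k))) ≤
          ‖qcdLatticeConnectedCorr (reg.β k) (2 * S k + 1) (fun fl => (reg.scheme m 0 0).mq fl k) A B (n k)‖

/-- POLYNOMIAL VOLUME GROWTH (the route header's NOT-DECOMPOSED-YET clause for the OS-closure node: "regs with
polynomial volume growth `∃ θ > 0, ∀ᶠ k, a_k^{−θ} ≤ a_k L_k` — free, H3 is volume-monotone"): the physical torus size
`a_k L_k` grows at least like a power of the cutoff, so that the Schwartz weight of a test tuple at the box faces beats the
periodic-seam contact term `≍ a_k⁻¹` of the box-truncated smearing (refuter evidence on stmt-QuantumFields-14654, kit j013894). -/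
def PolyVolumeGrowth (reg : QCDRegularisation Nf) : Prop :=
  ∃ θ : ℝ, 0 < θ ∧ ∀ᶠ k in Filter.atTop, (reg.a k)⁻¹ ^ θ ≤ reg.a k * reg.L k

variable {reg : QCDRegularisation Nf}

/-- LIVE (verbatim conclusion (i) of `CalibratedTightness`, hypothesis of `MassEquicontinuity`). -/
def Live (𝒞 : CalibratedSpeciesFamily reg) : Prop :=
  ∀ K : Set (Fin Nf → ℝ), IsCompact K → K ⊆ {m | ∀ fl, 0 < m fl} → ∀ᶠ k in Filter.atTop, ∀ m ∈ K,
    ∀ s : QCDField Nf, (∀ fl, s ≠ QCDField.pseudoIm fl fl) → (𝒞.scheme m).twoPoint k s s (thetaTest 4 𝒞.f₀) 𝒞.f₀ = 1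

/-- TIGHT-LOCAL ON ⁰𝒮 (verbatim conclusion (ii) of `CalibratedTightness`, hypothesis of `MassEquicontinuity`). -/
def TightLocal (𝒞 : CalibratedSpeciesFamily reg) : Prop :=
  ∀ K : Set (Fin Nf → ℝ), IsCompact K → K ⊆ {m | ∀ fl, 0 < m fl} → ∃ (s : ℕ) (α β : ℝ), ∀ R : ℝ,
    ∀ᶠ k in Filter.atTop, ∀ m ∈ K, ∀ (n : ℕ) (σ : Fin n → QCDField Nf)
      (f : Fin n → SchwartzMap (EuclideanSpace ℝ (Fin 4)) ℝ) (F : SchwartzMap (Fin n → EuclideanSpace ℝ (Fin 4)) ℂ),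
      (∀ i, tsupport (f i) ⊆ Metric.closedBall 0 R) → IsTensorOf F (fun i => ofRealTest (f i)) → IsOffDiagonal F →
        ‖qcdLatticeSchwinger (𝒞.scheme m) k n σ f‖ ≤ α * (n.factorial : ℝ) ^ β * schwartzNorm (n * s) F

/-- MASS-LIPSCHITZ (verbatim the conclusion of `MassEquicontinuity`). -/
def MassLipschitz (𝒞 : CalibratedSpeciesFamily reg) : Prop :=
  ∀ n : ℕ, n ≠ 0 → ∀ (σ : Fin n → QCDField Nf) (f : Fin n → SchwartzMap (EuclideanSpace ℝ (Fin 4)) ℝ)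
    (F : SchwartzMap (Fin n → EuclideanSpace ℝ (Fin 4)) ℂ), IsTensorOf F (fun i => ofRealTest (f i)) → IsOffDiagonal F →
      ∀ R : ℝ, (∀ i, tsupport (f i) ⊆ Metric.closedBall 0 R) → ∀ K : Set (Fin Nf → ℝ), IsCompact K →
        K ⊆ {m | ∀ fl, 0 < m fl} → ∃ C : ℝ, ∀ᶠ k in Filter.atTop, ∀ m ∈ K, ∀ m' ∈ K,
          ‖qcdLatticeSchwinger (𝒞.scheme m) k n σ f - qcdLatticeSchwinger (𝒞.scheme m') k n σ f‖ ≤ C * ‖m - m'‖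

/-- ROTATIONS RESTORED at flavour number `N_f` (verbatim the body of `RotationRestoration` at `Nf`). -/
def RotationsRestoredFor (Nf : ℕ) : Prop :=
  ∀ (sch : QCDScheme Nf), sch.HasAsymptoticScaling → (∀ fl : Fin Nf, ∀ᶠ k in Filter.atTop, -1 < sch.mq fl k) →
    (∃ Δ : ℝ, 0 < Δ ∧ sch.HasLatticeMassGap Δ) →
      ∀ S : LabelledSchwingerFamily (QCDField Nf) (EuclideanSpace ℝ (Fin 4)),
        (∀ n : ℕ, n ≠ 0 → ∀ (σ : Fin n → QCDField Nf) (f : Fin n → SchwartzMap (EuclideanSpace ℝ (Fin 4)) ℝ)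
          (F : SchwartzMap (Fin n → EuclideanSpace ℝ (Fin 4)) ℂ), IsTensorOf F (fun i => ofRealTest (f i)) →
            IsOffDiagonal F → Filter.Tendsto (fun k : ℕ => qcdLatticeSchwinger sch k n σ f) Filter.atTop (nhds (S n σ F))) →
        ∀ (n : ℕ) (σ : Fin n → QCDField Nf) (Rot : EuclideanSpace ℝ (Fin 4) ≃ₗᵢ[ℝ] EuclideanSpace ℝ (Fin 4)),
          LinearMap.det (Rot.toLinearEquiv : EuclideanSpace ℝ (Fin 4) →ₗ[ℝ] EuclideanSpace ℝ (Fin 4)) = 1 →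
            ∀ F : SchwartzMap (Fin n → EuclideanSpace ℝ (Fin 4)) ℂ, IsOffDiagonal F → S n σ (linActMulti Rot F) = S n σ F

/-! ## §1 The new stub statement: OS closure and the lower-bound clauses along ONE diagonal subsequence -/

/-- **OS CLOSURE AND CLAUSES ALONG ONE DIAGONAL SUBSEQUENCE** (the route header's NOT-DECOMPOSED-YET layer-2 child
of `LatticeToContinuum`, typed here for the first time).  For `N_f ∈ {2,3}` with rotations restored at `N_f`, every
regularisation with H1 `HasMassScaling`, H2 two-loop asymptotic scaling, H3 physical branch + uniform lattice gap at
every positive tuple, H4 lattice non-decoupling and POLYNOMIAL VOLUME GROWTH, and every calibrated species family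
that is LIVE, TIGHT-LOCAL on ⁰𝒮 and MASS-LIPSCHITZ (verbatim the conclusions of `CalibratedTightness` and
`MassEquicontinuity`): there is ONE strictly increasing `φ` such that the restriction `reg' = reg ∘ φ` carries, at
EVERY positive mass tuple, species renormalisations and OS data with `IsQCDAlong`, non-trivial non-Gaussian glue,
dynamical quarks and one `Δ > 0` with `T.HasMassGap Δ ∧ HasLatticeMassGap Δ` — the body of `QCDOf N_f` for `reg'`
(mass scaling and chirality at zero are NOT asked: the composition transports them).  Content: diagonal lemma over
the countable index, extension to ⁰𝒮 (Schwartz tails at the faces against the seam, paid by the polynomial volume),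
closedness of E0′/E2–E4 and of the gap, E1 from the hypothesis, RP window lower bounds.  Strictly weaker than the
crux: it presupposes the honest chirally-tunable lattice package, the calibrated family and rotation restoration. -/
def OSClosureAndClauses : Prop :=
  ∀ Nf : ℕ, Nf = 2 ∨ Nf = 3 → RotationsRestoredFor Nf →
    ∀ reg : QCDRegularisation Nf, reg.HasMassScaling → (reg.scheme 0 0 0).HasAsymptoticScaling →
      PhysicalBranchGap reg → NonDecoupling reg → PolyVolumeGrowth reg →
        ∀ 𝒞 : CalibratedSpeciesFamily reg, Live 𝒞 → TightLocal 𝒞 → MassLipschitz 𝒞 →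
          ∃ φ : ℕ → ℕ, StrictMono φ ∧ ∃ reg' : QCDRegularisation Nf,
            reg'.a = reg.a ∘ φ ∧ reg'.β = reg.β ∘ φ ∧ reg'.L = reg.L ∘ φ ∧ reg'.mcrit = reg.mcrit ∘ φ ∧
              reg'.Zm = reg.Zm ∘ φ ∧
              ∀ m : Fin Nf → ℝ, (∀ f, 0 < m f) →
                ∃ (z shift : QCDField Nf → ℕ → ℝ) (T : OSData (QCDField Nf) 4),
                  IsQCDAlong (reg'.scheme m z shift) T ∧ T.IsNontrivial QCDField.glue ∧
                    T.IsNonGaussian QCDField.glue ∧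
                      (∀ f g : Fin Nf, f ≠ g → T.IsNontrivial (QCDField.pseudoRe f g)) ∧
                        ∃ Δ > 0, T.HasMassGap Δ ∧ (reg'.scheme m z shift).HasLatticeMassGap Δ

/-- **VOLUME UPGRADE** (new statement, typed here): for `N_f ∈ {2,3}`, if some regularisation has H1–H4 and the
Goldstone bound G (verbatim the consequent of `ChiralTuning`), then some regularisation has H1–H4, G AND polynomial
volume growth.  Intended witness: the same `a, β, m_crit, Z_m` with tori `L⁺_k = max (L_k, ⌈a_k^{−1−θ}⌉)`; H1, H2 do not
read `L`, H3 is volume-monotone (`S ≥ L⁺_k ≥ L_k`), and the content is the finite-volume robustness of H4's connected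
two-point ratios and of G's Goldstone channel (thermodynamic limit from the uniform gap).  It is the hypothesis under
which the route header says the OS-closure node is to be filed ("free, H3 is volume-monotone"); isolated as its own
stub because `ChiralTuning`'s `∃ reg` does not record the volume schedule. -/
def VolumeUpgrade : Prop :=
  ∀ Nf : ℕ, Nf = 2 ∨ Nf = 3 →
    (∃ reg : QCDRegularisation Nf, reg.HasMassScaling ∧ (reg.scheme 0 0 0).HasAsymptoticScaling ∧
      PhysicalBranchGap reg ∧ NonDecoupling reg ∧ GoldstoneBound reg) →
    ∃ reg : QCDRegularisation Nf, reg.HasMassScaling ∧ (reg.scheme 0 0 0).HasAsymptoticScaling ∧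
      PhysicalBranchGap reg ∧ NonDecoupling reg ∧ GoldstoneBound reg ∧ PolyVolumeGrowth reg

/-! ## §2 The registered stubs (the ONLY `sorry`s of this file) -/

/-- **(S1) the light-quark lattice half** — filed item stmt-QuantumFields-14656 (`DiagonalSpine.LightQuarkGap`, crux
rank 7, open-problem), BY NAME: an H1–H3 witness upgrades to an HONEST regularisation with H4 lattice non-decoupling. -/
theorem stub_lightQuarkGap : LightQuarkGap := by
  sorry

/-- **(S2) the chiral point** — filed item stmt-QuantumFields-17436 (`DiagonalSpine.ChiralTuning`, crux rank 8,
open-problem), BY NAME: H1–H4 upgrades to H1–H4 ∧ G, the eventual (subsequence-stable) Goldstone lower bound. -/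
theorem stub_chiralTuning : ChiralTuning := by
  sorry

/-- **(S3) volume upgrade** — NEW statement (§1): H1–H4 ∧ G survive a polynomial enlargement of the tori.  Size M–L
(finite-volume robustness of connected two-point functions and of the Goldstone channel from uniform clustering). -/
theorem stub_volumeUpgrade : VolumeUpgrade := by
  sorry

/-- **(S4) E1 module** — filed item stmt-QuantumFields-8840 (`DiagonalSpine.RotationRestoration`, crux rank 4,
open-problem), BY NAME; consumed at the given `N_f` through `RotationsRestoredFor`. -/
theorem stub_rotationRestoration : RotationRestoration := by
  sorry

/-- **(S5) calibrated tightness** — filed item stmt-QuantumFields-14675 (`DiagonalSpine.CalibratedTightness`, crux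
rank 5), BY NAME: a live calibrated species family, tight-local on ⁰𝒮, locally uniformly in the masses. -/
theorem stub_calibratedTightness : CalibratedTightness := by
  sorry

/-- **(S6) mass-equicontinuity from the gap** — filed item stmt-QuantumFields-14676 (`DiagonalSpine.MassEquicontinuity`,
crux rank 6), BY NAME: the Lipschitz-in-`m` modulus of the calibrated lattice n-point functions, `∀ᶠ k`. -/
theorem stub_massEquicontinuity : MassEquicontinuity := by
  sorry

/-- **(S7) OS closure and the lower-bound clauses along one diagonal subsequence** — NEW statement (§1), the route
header's NOT-DECOMPOSED-YET child of the crux.  Size XL. -/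
theorem stub_osClosure : OSClosureAndClauses := by
  sorry

/-! ## §2b Name-keyed aliases of the two NEW statements — the hypotheses of `LatticeToContinuum_of`

The native skeleton audit (`#h21_check_skeleton`, run by `ledger skeleton check`) admits a hypothesis of the skeleton
theorem only if its head constant is a registered obligation (the five filed cruxes are `@[route_item]`s of the route
file) or is NAMED like a declared stub; `__Registered.stub_X` is the statement of `stub_X` under that name (device of
`Cruxes/QuasilocalAfterBlocking/Lines/birth.lean`: the `__` namespace is an implementation detail, so the audit's stub
report resolves each `stub_…` to the sorried theorem, not to the alias; the gate-reserved `@[stub]` attribute is not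
written by a planner).  Each alias is `rfl`-equal to its statement. -/
namespace __Registered

/-- Alias of `VolumeUpgrade` keyed by the registered stub name. -/
abbrev stub_volumeUpgrade : Prop := VolumeUpgrade
/-- Alias of `OSClosureAndClauses` keyed by the registered stub name. -/
abbrev stub_osClosure : Prop := OSClosureAndClauses

end __Registered

/-! ## §3 Glue (no `sorry` below this line): tail properties along a strictly increasing reindexing -/

/-- Exponential bookkeeping: from `c e^{−μ x} ≤ C e^{−ε x}` conclude `c e^{(ε−μ) x} ≤ C`. -/
theorem mul_exp_sub_le_of_le {c C μ ε x : ℝ}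
    (h : c * Real.exp (-(μ * x)) ≤ C * Real.exp (-(ε * x))) :
    c * Real.exp ((ε - μ) * x) ≤ C := by
  have hmul := mul_le_mul_of_nonneg_right h (Real.exp_pos (ε * x)).le
  calc c * Real.exp ((ε - μ) * x)
        = c * Real.exp (-(μ * x)) * Real.exp (ε * x) := by
          rw [mul_assoc, ← Real.exp_add]
          congr 1
          ring_nf
    _ ≤ C * Real.exp (-(ε * x)) * Real.exp (ε * x) := hmul
    _ = C := by rw [mul_assoc, ← Real.exp_add, neg_add_cancel, Real.exp_zero, mul_one]

/-- **Slow decay on tori `S_k ≥ L_k` kills the uniform lattice gap.** If `μ < ε`, `c > 0`, and along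
Euclidean-time separations `n_k ≤ S_k` on tori of side `2 S_k + 1 ≥ 2 L_k + 1` with `a_k n_k → ∞` the connected
correlation of `A, B` is frequently at least `c e^{−μ a_k n_k}`, then the scheme has no uniform lattice gap
`ε` (the gap bound at `S = S_k`, `n = n_k` would give `c e^{(ε−μ) a_k n_k} ≤ C` frequently, left side `→ ∞`). -/
theorem not_hasLatticeMassGap_of_slow_decay_tori (sch : QCDScheme Nf) {ε μ c : ℝ} (hμε : μ < ε) (hc : 0 < c)
    {R R' : ℕ} (A : QCDLatticeObservable Nf R) (B : QCDLatticeObservable Nf R') (S n : ℕ → ℕ)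
    (hLS : ∀ᶠ k in atTop, sch.L k ≤ S k) (hnS : ∀ᶠ k in atTop, n k ≤ S k)
    (hdiv : Tendsto (fun k => sch.a k * n k) atTop atTop)
    (hfreq : ∃ᶠ k in atTop, c * Real.exp (-(μ * (sch.a k * n k))) ≤
      ‖qcdLatticeConnectedCorr (sch.β k) (2 * S k + 1) (fun fl => sch.mq fl k) A B (n k)‖) :
    ¬ sch.HasLatticeMassGap ε := by
  intro hgap
  obtain ⟨C, hC⟩ := hgap R R' A B
  have hev : ∀ᶠ k in atTop,
      ‖qcdLatticeConnectedCorr (sch.β k) (2 * S k + 1) (fun fl => sch.mq fl k) A B (n k)‖ ≤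
        C * Real.exp (-(ε * (sch.a k * n k))) :=
    (hC.and (hLS.and hnS)).mono fun k hk => hk.1 (S k) hk.2.1 (n k) hk.2.2
  have hexp : Tendsto (fun k => c * Real.exp ((ε - μ) * (sch.a k * n k))) atTop atTop :=
    (Real.tendsto_exp_atTop.comp (hdiv.const_mul_atTop (sub_pos.2 hμε))).const_mul_atTop hc
  have hgt : ∀ᶠ k in atTop, C < c * Real.exp ((ε - μ) * (sch.a k * n k)) :=
    hexp.eventually_gt_atTop C
  obtain ⟨k, hk₁, hk₂, hk₃⟩ := (hfreq.and_eventually (hev.and hgt)).exists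
  exact absurd (mul_exp_sub_le_of_le (hk₁.trans hk₂)) (not_le.2 hk₃)

/-- **`HasMassScaling` is a tail property**: it survives the restriction along a strictly increasing `φ`
(it reads only `a_k` and `Z_m(k)`). -/
theorem hasMassScaling_restrict (reg reg' : QCDRegularisation Nf) (φ : ℕ → ℕ) (hφ : StrictMono φ)
    (ha : reg'.a = reg.a ∘ φ) (hZ : reg'.Zm = reg.Zm ∘ φ) (h : reg.HasMassScaling) :
    reg'.HasMassScaling := by
  obtain ⟨a', a'pos, a'lim, β', L', L'lim, mc', Z', Z'pos⟩ := reg'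
  dsimp only at ha hZ
  subst ha hZ
  obtain ⟨c, hc, ht⟩ := h
  exact ⟨c, hc, ht.comp hφ.tendsto_atTop⟩

/-- **The Goldstone bound of `reg` makes every restriction `reg ∘ φ` chiral at zero** (the content of the
route's support `GoldstonePersistence` that the composition needs): at the positive tuple `m` of G the
restricted scheme inherits, along `φ`, separations `n_{φ j} ≤ S_{φ j}` with `a n → ∞` and the lower bound
`c e^{−μ a n}`, `μ < ε`, on tori `S_{φ j} ≥ L_{φ j}` — so it has no uniform lattice gap `ε`. -/
theorem isChiralAtZero_restrict (reg reg' : QCDRegularisation Nf) (φ : ℕ → ℕ) (hφ : StrictMono φ)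
    (ha : reg'.a = reg.a ∘ φ) (hβ : reg'.β = reg.β ∘ φ) (hL : reg'.L = reg.L ∘ φ)
    (hmc : reg'.mcrit = reg.mcrit ∘ φ) (hZ : reg'.Zm = reg.Zm ∘ φ) (hG : GoldstoneBound reg) :
    reg'.IsChiralAtZero := by
  obtain ⟨a', a'pos, a'lim, β', L', L'lim, mc', Z', Z'pos⟩ := reg'
  dsimp only at ha hβ hL hmc hZ
  subst ha hβ hL hmc hZ
  intro ε hε
  obtain ⟨m, hm, μ, c, hμε, hc, R, R', A, B, S, n, hLS, hnS, hdiv, hev⟩ := hG ε hε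
  exact ⟨m, hm, not_hasLatticeMassGap_of_slow_decay_tori _ hμε hc A B (S ∘ φ) (n ∘ φ)
    (Eventually.of_forall fun j => hLS (φ j)) (Eventually.of_forall fun j => hnS (φ j))
    (hdiv.comp hφ.tendsto_atTop) ((hφ.tendsto_atTop.eventually hev).frequently)⟩

/-! ## §4 Composition (kernel-checked): the crux BY NAME from the seven stubs -/

/-- **THE CRUX FROM THE SEVEN STUBS** — concludes `Summit.QuantumFields.QCD.Theses.DiagonalSpine.LatticeToContinuum`
BY NAME (type literally the route decl); hypotheses = the five filed cruxes by name and the two new statements under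
their registered stub names (`__Registered.stub_volumeUpgrade ≡ VolumeUpgrade`, `__Registered.stub_osClosure ≡
OSClosureAndClauses`, `rfl`).  Given `FullLatticeGap` and `N_f ∈ {2,3}`: its (possibly decoupled) witness
is upgraded to an honest regularisation (S1), pinned to the chiral point (S2), given polynomial volumes (S3); on it the
calibrated family exists, live and tight-local (S5), hence mass-Lipschitz (S6); the OS-closure node (S7, fed with
rotation restoration S4 at this `N_f`) returns ONE subsequence `φ` and the restricted regularisation carrying the
massive body at every positive tuple; mass scaling survives the restriction and the Goldstone bound of the unrestricted
regularisation makes the restriction chiral at zero (§3) — i.e. `QCDOf N_f`; both flavour numbers give `QCD`. -/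
theorem LatticeToContinuum_of :
    LightQuarkGap → ChiralTuning → __Registered.stub_volumeUpgrade → RotationRestoration → CalibratedTightness →
      MassEquicontinuity → __Registered.stub_osClosure → LatticeToContinuum := by
  intro hLQ hCT hVU hRR hCal hME hOS hFLG
  have key : ∀ Nf : ℕ, Nf = 2 ∨ Nf = 3 → QCDOf Nf := by
    intro Nf hNf
    -- lattice side: FullLatticeGap's (possibly decoupled) witness ⟶ honest ⟶ chirally tuned regularisation
    obtain ⟨reg₁, h₁, h₂, h₃, h₄⟩ := hLQ Nf hNf (hFLG Nf hNf)
    obtain ⟨reg₂, f₁, f₂, f₃, f₄, fG⟩ := hCT Nf hNf ⟨reg₁, h₁, h₂, h₃, h₄⟩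
    -- polynomial enlargement of the tori, keeping H1–H4 and the Goldstone bound
    obtain ⟨reg, g₁, g₂, g₃, g₄, gG, gV⟩ := hVU Nf hNf ⟨reg₂, f₁, f₂, f₃, f₄, fG⟩
    -- continuum side: calibrated family, live and tight-local, hence mass-Lipschitz
    obtain ⟨𝒞, hlive, htight⟩ := hCal Nf hNf reg g₁ g₂ g₃ g₄
    have hlip := hME Nf hNf reg g₁ g₂ g₃ 𝒞 hlive htight
    -- one diagonal subsequence along which the OS data exist for every mass tuple
    obtain ⟨φ, hφ, reg', ha, hβ, hL, hmc, hZ, hbody⟩ :=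
      hOS Nf hNf (hRR Nf) reg g₁ g₂ g₃ g₄ gV 𝒞 hlive htight hlip
    -- the restricted regularisation keeps mass scaling and is chiral at zero (Goldstone bound of `reg`)
    exact ⟨reg', hasMassScaling_restrict reg reg' φ hφ ha hZ g₁,
      isChiralAtZero_restrict reg reg' φ hφ ha hβ hL hmc hZ gG, hbody⟩
  exact ⟨key 2 (Or.inl rfl), key 3 (Or.inr rfl)⟩

/-- The crux along this skeleton, from the registered stubs (sorries only inside `stub_*`). -/
theorem latticeToContinuum_of_stubs : LatticeToContinuum :=
  LatticeToContinuum_of stub_lightQuarkGap stub_chiralTuning stub_volumeUpgrade stub_rotationRestoration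
    stub_calibratedTightness stub_massEquicontinuity stub_osClosure

end Summit.QuantumFields.QCD.Cruxes.LatticeToContinuum.Birth

end
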